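import Summits.AtomisticToContinuum.BoseEinsteinCondensation.Theses.BECThomsonPrinciple
import HarnessLib

/-!
# Line `gp-parameter-split` — crux `BECThomsonPrinciple.DensityResponse` (stmt-AtomisticToContinuum-9481)

Strategist skeleton (wall-breaker p1, 2026-08-17).  The crux is cut along the Gross–Pitaevskii parameter
`g(N, L) = N·a/L` of the box (box side in healing lengths `= √g`; at fixed `g` the dilute limit of the crux IS
the Gross–Pitaevskii limit, the thermodynamic limit is `g → ∞`):

* `stub_mesoscopic`  — the crux on boxes with `N·a ≤ Λ₀·L`, for EVERY `Λ₀ > 0` (GP-regime Bogoliubov theory: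
  existing mathematics, XL; arXiv:1801.01389, arXiv:2108.11129, arXiv:2106.11949);
* `stub_macroscopic` — the crux on boxes with `Λ₀·L ≤ N·a`, for SOME `Λ₀ > 0` (the thermodynamic half:
  the research-open core, = Theorem X of CORE-c1/CORE-c3 on large boxes; HARDEST stub);
* `DensityResponse_of : (meso) → (macro) → DensityResponse` — kernel-checked composition (ρ₀ := min, C := max,
  N₀ := max, case split on `N·a ≤ Λ₀·L`, monotonicity of the chord in `C`); `DensityResponse_of_stubs` = the
  crux modulo the two stubs.

Card: `Lines/gp-parameter-split.md`; census: `STRATEGY-CENSUS.md` (same directory).  The same glue, as a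
landable Theorems file, is item evidence `BECThomsonPrincipleDensityResponseSplit.lean` on the crux item.
-/

namespace Summit.AtomisticToContinuum.BoseEinsteinCondensation.Cruxes.DensityResponse.GpParameterSplit

open MeasureTheory
open scoped ENNReal
open Literature.MathematicalPhysics.QuantumManyBody.BoseGas
open Summit.AtomisticToContinuum.BoseEinsteinCondensation.Theses

noncomputable section

/-! ## Registered stubs -/

/-- **S1 (mesoscopic half, GP regime).** `DensityResponse` restricted to boxes of Gross–Pitaevskii parameter
`N·a/L ≤ Λ₀`, for every `Λ₀ > 0` (constants may depend on `Λ₀`).  In such boxes only finitely many window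
modes occur (`‖n‖ ≤ M√(Λ₀/a)/2π`) and the dilute limit is the GP limit: optimal-rate BEC + Bogoliubov gap for
the weakly modulated torus condensate (`s ≤ 2(k²+ρa)/C`), then `m₋₁ ≤ m₁/gap²` and the landed modulation
bootstrap; `a(v) = 0` is the landed free chord.  [cite: BoccatoEtAl2019Acta, Thm 1.1] -/
theorem stub_mesoscopic :
    ∀ v : ℝ → ENNReal, Literature.MathematicalPhysics.QuantumManyBody.BoseGas.IsRepulsiveFiniteRange v → ∀ M : ℝ, 0 < M → ∀ Λ₀ : ℝ, 0 < Λ₀ → ∃ ρ₀ C : ℝ, 0 < ρ₀ ∧ 0 < C ∧ ∃ N₀ : ℕ, ∀ N : ℕ, N₀ ≤ N → ∀ L : ℝ, 0 < L → (N : ℝ) ≤ ρ₀ * L ^ 3 → (N : ℝ) * (Literature.MathematicalPhysics.QuantumManyBody.BoseGas.scatteringLength v).toReal ≤ Λ₀ * L → ∀ n : Fin 3 → ℤ, n ≠ 0 → 2 * Real.pi * ‖(fun j => (n j : ℝ))‖ / L ≤ M * Real.sqrt (N / L ^ 3) → ∀ s : ℝ, 0 ≤ s → ∀ Φ : Literature.MathematicalPhysics.QuantumManyBody.BoseGas.PeriodicTrialState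 N L, Literature.MathematicalPhysics.QuantumManyBody.BoseGas.periodicGroundStateEnergy v N L + ENNReal.ofReal (s * |∫ X in Literature.MathematicalPhysics.QuantumManyBody.BoseGas.cellN N L, (∑ i, 2 * Real.cos (2 * Real.pi / L * ∑ j, (n j : ℝ) * X i j)) * ‖Φ.ψ X‖ ^ 2|) ≤ Literature.MathematicalPhysics.QuantumManyBody.BoseGas.periodicEnergy v Φ + ENNReal.ofReal (C * s ^ 2 * N / ((2 * Real.pi * ‖(fun j => (n j : ℝ))‖ / L) ^ 2 + N / L ^ 3 * (Literature.MathematicalPhysics.QuantumManyBody.BoseGas.scatteringLength v).toReal)) := by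
  sorry

/-- **S2 (macroscopic half, thermodynamic regime) — HARDEST.** `DensityResponse` restricted to boxes with
`Λ₀·L ≤ N·a` for some `Λ₀ > 0` (prover's choice): boxes of at least `√Λ₀` healing lengths, containing the
thermodynamic limit at every fixed density `≤ ρ₀`.  This is the N-uniform (g-uniform) linear-response bound
of the dilute Bose gas — Theorem X of CORE-c1 §3 / CORE-c3 §3 on large boxes; no printed method reaches it
(see STRATEGY-CENSUS.md).  [cite: LSSY2005, Ch. 5] -/
theorem stub_macroscopic :
    ∀ v : ℝ → ENNReal, Literature.MathematicalPhysics.QuantumManyBody.BoseGas.IsRepulsiveFiniteRange v → ∀ M : ℝ, 0 < M → ∃ Λ₀ : ℝ, 0 < Λ₀ ∧ ∃ ρ₀ C : ℝ, 0 < ρ₀ ∧ 0 < C ∧ ∃ N₀ : ℕ, ∀ N : ℕ, N₀ ≤ N → ∀ L : ℝ, 0 < L → (N : ℝ) ≤ ρ₀ * L ^ 3 → Λ₀ * L ≤ (N : ℝ) * (Literature.MathematicalPhysics.QuantumManyBody.BoseGas.scatteringLength v).toReal → ∀ n : Fin 3 → ℤ, n ≠ 0 → 2 * Real.pi * ‖(fun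 j => (n j : ℝ))‖ / L ≤ M * Real.sqrt (N / L ^ 3) → ∀ s : ℝ, 0 ≤ s → ∀ Φ : Literature.MathematicalPhysics.QuantumManyBody.BoseGas.PeriodicTrialState N L, Literature.MathematicalPhysics.QuantumManyBody.BoseGas.periodicGroundStateEnergy v N L + ENNReal.ofReal (s * |∫ X in Literature.MathematicalPhysics.QuantumManyBody.BoseGas.cellN N L, (∑ i, 2 * Real.cos (2 * Real.pi / L * ∑ j, (n j : ℝ) * X i j)) * ‖Φ.ψ X‖ ^ 2|) ≤ Literature.MathematicalPhysics.QuantumManyBody.BoseGas.periodicEnergy v Φ + ENNReal.ofReal (C * s ^ 2 * N / ((2 * Real.pi * ‖(fun j => (n j : ℝ))‖ / L) ^ 2 + N / L ^ 3 * (Literature.MathematicalPhysics.QuantumManyBody.BoseGas.scatteringLength v).toReal)) := by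
  sorry

/-! ## Composition (no `sorry` below this line) -/

/-- Monotonicity of the chord's right-hand side in the constant: `E + C s² x/d ≤ E + C' s² x/d` in
`ℝ≥0∞` for `C ≤ C'`, `s² x ≥ 0`, `d ≥ 0` (Lean's `y / 0 = 0` keeps the degenerate denominator
monotone too). [folklore] -/
theorem chord_rhs_mono {E : ℝ≥0∞} {C C' s x d : ℝ} (hCC' : C ≤ C') (hx : 0 ≤ s ^ 2 * x)
    (hd : 0 ≤ d) :
    E + ENNReal.ofReal (C * s ^ 2 * x / d) ≤ E + ENNReal.ofReal (C' * s ^ 2 * x / d) := by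
  gcongr E + ENNReal.ofReal ?_
  have hnum : C * s ^ 2 * x ≤ C' * s ^ 2 * x := by nlinarith
  exact div_le_div_of_nonneg_right hnum hd

/-- **`DensityResponse` from the two halves** (type literally `S1-statement → S2-statement → the route decl`).
[folklore] -/
theorem DensityResponse_of :
    (∀ v : ℝ → ENNReal, Literature.MathematicalPhysics.QuantumManyBody.BoseGas.IsRepulsiveFiniteRange v → ∀ M : ℝ, 0 < M → ∀ Λ₀ : ℝ, 0 < Λ₀ → ∃ ρ₀ C : ℝ, 0 < ρ₀ ∧ 0 < C ∧ ∃ N₀ : ℕ, ∀ N : ℕ, N₀ ≤ N → ∀ L : ℝ, 0 < L → (N : ℝ) ≤ ρ₀ * L ^ 3 → (N : ℝ) * (Literature.MathematicalPhysics.QuantumManyBody.BoseGas.scatteringLength v).toReal ≤ Λ₀ * L → ∀ n : Fin 3 → ℤ, n ≠ 0 → 2 * Real.pi * ‖(fun j => (n j : ℝ))‖ / L ≤ M * Real.sqrt (N / L ^ 3) → ∀ s : ℝ, 0 ≤ s → ∀ Φ : Literature.MathematicalPhysics.QuantumManyBody.BoseGas.PeriodicTrialState N L, Literature.MathematicalPhysics.QuantumManyBody.BoseGas.periodicGroundStateEnergy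 v N L + ENNReal.ofReal (s * |∫ X in Literature.MathematicalPhysics.QuantumManyBody.BoseGas.cellN N L, (∑ i, 2 * Real.cos (2 * Real.pi / L * ∑ j, (n j : ℝ) * X i j)) * ‖Φ.ψ X‖ ^ 2|) ≤ Literature.MathematicalPhysics.QuantumManyBody.BoseGas.periodicEnergy v Φ + ENNReal.ofReal (C * s ^ 2 * N / ((2 * Real.pi * ‖(fun j => (n j : ℝ))‖ / L) ^ 2 + N / L ^ 3 * (Literature.MathematicalPhysics.QuantumManyBody.BoseGas.scatteringLength v).toReal))) →
    (∀ v : ℝ → ENNReal, Literature.MathematicalPhysics.QuantumManyBody.BoseGas.IsRepulsiveFiniteRange v → ∀ M : ℝ, 0 < M → ∃ Λ₀ : ℝ, 0 < Λ₀ ∧ ∃ ρ₀ C : ℝ, 0 < ρ₀ ∧ 0 < C ∧ ∃ N₀ : ℕ, ∀ N : ℕ, N₀ ≤ N → ∀ L : ℝ, 0 < L → (N : ℝ) ≤ ρ₀ * L ^ 3 → Λ₀ * L ≤ (N : ℝ) * (Literature.MathematicalPhysics.QuantumManyBody.BoseGas.scatteringLength v).toReal → ∀ n : Fin 3 → ℤ,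 n ≠ 0 → 2 * Real.pi * ‖(fun j => (n j : ℝ))‖ / L ≤ M * Real.sqrt (N / L ^ 3) → ∀ s : ℝ, 0 ≤ s → ∀ Φ : Literature.MathematicalPhysics.QuantumManyBody.BoseGas.PeriodicTrialState N L, Literature.MathematicalPhysics.QuantumManyBody.BoseGas.periodicGroundStateEnergy v N L + ENNReal.ofReal (s * |∫ X in Literature.MathematicalPhysics.QuantumManyBody.BoseGas.cellN N L, (∑ i, 2 * Real.cos (2 * Real.pi / L * ∑ j, (n j : ℝ) * X i j)) * ‖Φ.ψ X‖ ^ 2|) ≤ Literature.MathematicalPhysics.QuantumManyBody.BoseGas.periodicEnergy v Φ + ENNReal.ofReal (C * s ^ 2 * N / ((2 * Real.pi * ‖(fun j => (n j : ℝ))‖ / L) ^ 2 + N / L ^ 3 * (Literature.MathematicalPhysics.QuantumManyBody.BoseGas.scatteringLength v).toReal))) →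
    BECThomsonPrinciple.DensityResponse := by
  intro hmeso hmacro v hv M hM
  obtain ⟨Λ₀, hΛ₀, ρ₂, C₂, hρ₂, hC₂, N₂, H₂⟩ := hmacro v hv M hM
  obtain ⟨ρ₁, C₁, hρ₁, hC₁, N₁, H₁⟩ := hmeso v hv M hM Λ₀ hΛ₀
  refine ⟨min ρ₁ ρ₂, max C₁ C₂, lt_min hρ₁ hρ₂, lt_max_of_lt_left hC₁, max N₁ N₂, ?_⟩
  intro N hN L hL hNL
  have hN₁ : N₁ ≤ N := le_trans (le_max_left _ _) hN
  have hN₂ : N₂ ≤ N := le_trans (le_max_right _ _) hN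
  have hL3 : 0 ≤ L ^ 3 := by positivity
  have hNL₁ : (N : ℝ) ≤ ρ₁ * L ^ 3 :=
    hNL.trans (mul_le_mul_of_nonneg_right (min_le_left _ _) hL3)
  have hNL₂ : (N : ℝ) ≤ ρ₂ * L ^ 3 :=
    hNL.trans (mul_le_mul_of_nonneg_right (min_le_right _ _) hL3)
  intro n hn hwin s hs Φ
  have hx : 0 ≤ s ^ 2 * (N : ℝ) := by positivity
  have hd : 0 ≤ (2 * Real.pi * ‖(fun j => (n j : ℝ))‖ / L) ^ 2 +
      N / L ^ 3 * (scatteringLength v).toReal := by positivity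
  rcases le_total ((N : ℝ) * (scatteringLength v).toReal) (Λ₀ * L) with hle | hge
  · exact (H₁ N hN₁ L hL hNL₁ hle n hn hwin s hs Φ).trans (chord_rhs_mono (le_max_left _ _) hx hd)
  · exact (H₂ N hN₂ L hL hNL₂ hge n hn hwin s hs Φ).trans (chord_rhs_mono (le_max_right _ _) hx hd)


/-- The crux modulo the registered stubs. [folklore] -/
theorem DensityResponse_of_stubs : BECThomsonPrinciple.DensityResponse :=
  DensityResponse_of stub_mesoscopic stub_macroscopic

end

end Summit.AtomisticToContinuum.BoseEinsteinCondensation.Cruxes.DensityResponse.GpParameterSplit
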